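import Mathlib.Analysis.SpecialFunctions.Pow.Real
import Mathlib.Analysis.SpecialFunctions.Sqrt
import Mathlib.Analysis.Calculus.Deriv.Pow
import Mathlib.Analysis.Calculus.Deriv.Inv
import Mathlib.Analysis.Calculus.Deriv.Add
import Mathlib.Analysis.Calculus.Deriv.Mul
import Literature.MathematicalPhysics.StatisticalMechanics.Crystallization
import HarnessLib

/-!
# The Lennard-Jones potential in the squared-distance variable: convexity on the nearest-bond range

For energy certificates built on squared edge lengths `s = r²` (Cayley–Menger / frame-free
coordinates) the relevant one-variable function is
`Ṽ(s) = V_LJ(√s) = (1/12) s⁻⁶ − (1/6) s⁻³` (Blanc–Lewin normalisation of `V_LJ`, minimum `−1/12` at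
`s = 1`).  Its second derivative `Ṽ''(s) = (7/2) s⁻⁸ − 2 s⁻⁵ = s⁻⁸ (7/2 − 2 s³)` is positive exactly
for `s³ < 7/4`, i.e. `r < (7/4)^{1/6} ≈ 1.0978`: `Ṽ` is CONVEX on the whole range of nearest-neighbour
squared lengths of a `1/20`-good close-packed environment (`r ∈ [0.893, 1.05]`), and concave beyond.
We record, with the explicit derivative `Ṽ'(s) = −(1/2) s⁻⁷ + (1/2) s⁻⁴`:

* `lennardJones_sqrt` : `V_LJ(√s) = (1/12) s⁻⁶ − (1/6) s⁻³` for `0 ≤ s`;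
* `hasDerivAt_lennardJonesSq` : the derivative formula (`s ≠ 0`);
* `lennardJonesSq_bregman_nonneg` : the **Bregman (tangent-line) inequality**
  `Ṽ(t) − Ṽ(s) − Ṽ'(s)(t − s) ≥ 0` for `s, t ∈ (0, 10/9]` (`√(10/9) ≈ 1.054`), by the explicit
  factorisation `12uv·B = (u − v)²·u·K(u,v)`, `u = s⁻¹, v = t⁻¹`, `K ≥ 0` for `u, v ≥ 9/10`;
* `lennardJonesSq_bregman_ge` : the quantitative form `≥ (1/8)(t − s)²` on the same range
  (`Ṽ'' ≥ 0.325` there).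

Elementary calculus on the formula (3) of Blanc–Lewin 2015; no statement about configurations.

## References
* X. Blanc, M. Lewin, *The crystallization conjecture: a review*, EMS Surv. Math. Sci. 2 (2015),
  §1.1 (3). [BlancLewin2015]
-/

noncomputable section

namespace Literature.MathematicalPhysics.StatisticalMechanics

/-- `V_LJ(√s) = (1/12) s⁻⁶ − (1/6) s⁻³` for `s ≥ 0` (the Lennard-Jones potential as a function of
the squared distance). [cite: BlancLewin2015, §1.1 (3)] -/
theorem lennardJones_sqrt {s : ℝ} (hs : 0 ≤ s) :
    lennardJones (Real.sqrt s) = (1 / 12) * s⁻¹ ^ 6 - (1 / 6) * s⁻¹ ^ 3 := by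
  unfold lennardJones
  have h2 : (Real.sqrt s)⁻¹ ^ 2 = s⁻¹ := by
    rw [inv_pow, Real.sq_sqrt hs]
  have h12 : (Real.sqrt s)⁻¹ ^ 12 = s⁻¹ ^ 6 := by
    rw [show (12 : ℕ) = 2 * 6 by norm_num, pow_mul, h2]
  have h6 : (Real.sqrt s)⁻¹ ^ 6 = s⁻¹ ^ 3 := by
    rw [show (6 : ℕ) = 2 * 3 by norm_num, pow_mul, h2]
  rw [h12, h6]

/-- The derivative of `Ṽ(s) = (1/12) s⁻⁶ − (1/6) s⁻³` is `Ṽ'(s) = −(1/2) s⁻⁷ + (1/2) s⁻⁴` (`s ≠ 0`).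
[cite: BlancLewin2015, §1.1 (3)] -/
theorem hasDerivAt_lennardJonesSq {s : ℝ} (hs : s ≠ 0) :
    HasDerivAt (fun s : ℝ => (1 / 12) * s⁻¹ ^ 6 - (1 / 6) * s⁻¹ ^ 3)
      (-(1 / 2) * s⁻¹ ^ 7 + (1 / 2) * s⁻¹ ^ 4) s := by
  have hinv : HasDerivAt (fun s : ℝ => s⁻¹) (-(s ^ 2)⁻¹) s := hasDerivAt_inv hs
  have h6 : HasDerivAt (fun y : ℝ => y⁻¹ ^ 6) (((6 : ℕ) : ℝ) * s⁻¹ ^ (6 - 1) * -(s ^ 2)⁻¹) s :=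
    hinv.pow 6
  have h3 : HasDerivAt (fun y : ℝ => y⁻¹ ^ 3) (((3 : ℕ) : ℝ) * s⁻¹ ^ (3 - 1) * -(s ^ 2)⁻¹) s :=
    hinv.pow 3
  have h : HasDerivAt (fun y : ℝ => (1 / 12) * y⁻¹ ^ 6 - (1 / 6) * y⁻¹ ^ 3)
      ((1 / 12) * (((6 : ℕ) : ℝ) * s⁻¹ ^ (6 - 1) * -(s ^ 2)⁻¹) -
        (1 / 6) * (((3 : ℕ) : ℝ) * s⁻¹ ^ (3 - 1) * -(s ^ 2)⁻¹)) s :=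
    HasDerivAt.sub (HasDerivAt.const_mul (1 / 12) h6) (HasDerivAt.const_mul (1 / 6) h3)
  refine HasDerivAt.congr_deriv h ?_
  push_cast
  field_simp
  ring

/-- **Bregman inequality for `Ṽ` on the nearest-bond range**: for `0 < s ≤ 10/9` and
`0 < t ≤ 10/9`, `Ṽ(t) − Ṽ(s) − Ṽ'(s)(t − s) ≥ 0` — the tangent line at `s` lies below the graph
(convexity of `Ṽ` for `s³ ≤ 7/4 ⊃ (0, 10/9]`).  Proof: with `u = s⁻¹ ≥ 9/10`, `v = t⁻¹ ≥ 9/10`,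
`12uv·B = (u − v)²·u·K`, `K = 6u⁵+5u⁴v+4u³v²+3u²v³+2uv⁴+v⁵−6u²−4uv−2v² ≥ (9m³−6)u²+(7m³−4)uv+(5m³−2)v² ≥ 0`,
`m = 9/10`. [cite: BlancLewin2015, §1.1 (3)] -/
theorem lennardJonesSq_bregman_nonneg {s t : ℝ} (hs : 0 < s) (hs' : s ≤ 10 / 9) (ht : 0 < t)
    (ht' : t ≤ 10 / 9) :
    0 ≤ ((1 / 12) * t⁻¹ ^ 6 - (1 / 6) * t⁻¹ ^ 3) - ((1 / 12) * s⁻¹ ^ 6 - (1 / 6) * s⁻¹ ^ 3) -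
      (-(1 / 2) * s⁻¹ ^ 7 + (1 / 2) * s⁻¹ ^ 4) * (t - s) := by
  set u : ℝ := s⁻¹ with hu
  set v : ℝ := t⁻¹ with hv
  have hu0 : 0 < u := inv_pos.2 hs
  have hv0 : 0 < v := inv_pos.2 ht
  have hum : 9 / 10 ≤ u := by
    rw [hu, le_inv_comm₀ (by norm_num) hs]; norm_num; linarith
  have hvm : 9 / 10 ≤ v := by
    rw [hv, le_inv_comm₀ (by norm_num) ht]; norm_num; linarith
  have hts : t - s = (u - v) / (u * v) := by
    rw [hu, hv]; field_simp
  rw [hts]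
  -- the polynomial `K` and its positivity
  have hu3 : (9 / 10) ^ 3 ≤ u ^ 3 := pow_le_pow_left₀ (by norm_num) hum 3
  have hv3 : (9 / 10) ^ 3 ≤ v ^ 3 := pow_le_pow_left₀ (by norm_num) hvm 3
  have hK : 0 ≤ 6 * u ^ 5 + 5 * u ^ 4 * v + 4 * u ^ 3 * v ^ 2 + 3 * u ^ 2 * v ^ 3 + 2 * u * v ^ 4 +
      v ^ 5 - 6 * u ^ 2 - 4 * u * v - 2 * v ^ 2 := by
    -- termwise: `u⁵ ≥ m³u²`, `u⁴v ≥ m³uv`, `u³v² ≥ m³v²`, `u²v³ ≥ m³u²`, `uv⁴ ≥ m³uv`, `v⁵ ≥ m³v²`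
    have h1 : (9 / 10) ^ 3 * u ^ 2 ≤ u ^ 5 := by
      nlinarith [mul_nonneg (sub_nonneg.2 hu3) (sq_nonneg u)]
    have h2 : (9 / 10) ^ 3 * (u * v) ≤ u ^ 4 * v := by
      nlinarith [mul_nonneg (sub_nonneg.2 hu3) (mul_pos hu0 hv0).le]
    have h3 : (9 / 10) ^ 3 * v ^ 2 ≤ u ^ 3 * v ^ 2 := by
      nlinarith [mul_nonneg (sub_nonneg.2 hu3) (sq_nonneg v)]
    have h4 : (9 / 10) ^ 3 * u ^ 2 ≤ u ^ 2 * v ^ 3 := by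
      nlinarith [mul_nonneg (sub_nonneg.2 hv3) (sq_nonneg u)]
    have h5 : (9 / 10) ^ 3 * (u * v) ≤ u * v ^ 4 := by
      nlinarith [mul_nonneg (sub_nonneg.2 hv3) (mul_pos hu0 hv0).le]
    have h6 : (9 / 10) ^ 3 * v ^ 2 ≤ v ^ 5 := by
      nlinarith [mul_nonneg (sub_nonneg.2 hv3) (sq_nonneg v)]
    nlinarith [sq_nonneg u, sq_nonneg v, mul_pos hu0 hv0]
  have huv : 0 < u * v := mul_pos hu0 hv0
  -- the factorisation `12 u v · B = (u − v)² · u · K`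
  have key : ((1 / 12) * v ^ 6 - (1 / 6) * v ^ 3) - ((1 / 12) * u ^ 6 - (1 / 6) * u ^ 3) -
      (-(1 / 2) * u ^ 7 + (1 / 2) * u ^ 4) * ((u - v) / (u * v)) =
      (u - v) ^ 2 * u * (6 * u ^ 5 + 5 * u ^ 4 * v + 4 * u ^ 3 * v ^ 2 + 3 * u ^ 2 * v ^ 3 +
        2 * u * v ^ 4 + v ^ 5 - 6 * u ^ 2 - 4 * u * v - 2 * v ^ 2) / (12 * (u * v)) := by
    field_simp
    ring
  rw [key]
  apply div_nonneg _ (by positivity)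
  have := sq_nonneg (u - v)
  positivity

/-- **Quantitative Bregman inequality**: on the same range, `Ṽ(t) − Ṽ(s) − Ṽ'(s)(t − s) ≥ (1/8)(t − s)²`
(`Ṽ'' ≥ 0.325 > 1/4` on `(0, 10/9]`).  Proof: `12uv·[B − (t−s)²/8] = (u − v)²·(u·K − 3/(2uv))` and
`u²v·K ≥ 3/2` termwise for `u, v ≥ 9/10`. [cite: BlancLewin2015, §1.1 (3)] -/
theorem lennardJonesSq_bregman_ge {s t : ℝ} (hs : 0 < s) (hs' : s ≤ 10 / 9) (ht : 0 < t)
    (ht' : t ≤ 10 / 9) :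
    (1 / 8) * (t - s) ^ 2 ≤ ((1 / 12) * t⁻¹ ^ 6 - (1 / 6) * t⁻¹ ^ 3) -
      ((1 / 12) * s⁻¹ ^ 6 - (1 / 6) * s⁻¹ ^ 3) - (-(1 / 2) * s⁻¹ ^ 7 + (1 / 2) * s⁻¹ ^ 4) * (t - s) := by
  set u : ℝ := s⁻¹ with hu
  set v : ℝ := t⁻¹ with hv
  have hu0 : 0 < u := inv_pos.2 hs
  have hv0 : 0 < v := inv_pos.2 ht
  have hum : 9 / 10 ≤ u := by
    rw [hu, le_inv_comm₀ (by norm_num) hs]; norm_num; linarith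
  have hvm : 9 / 10 ≤ v := by
    rw [hv, le_inv_comm₀ (by norm_num) ht]; norm_num; linarith
  have hts : t - s = (u - v) / (u * v) := by
    rw [hu, hv]; field_simp
  rw [hts]
  have huv : 0 < u * v := mul_pos hu0 hv0
  have hu3 : (9 / 10) ^ 3 ≤ u ^ 3 := pow_le_pow_left₀ (by norm_num) hum 3
  have hv3 : (9 / 10) ^ 3 ≤ v ^ 3 := pow_le_pow_left₀ (by norm_num) hvm 3
  -- `u² v K − 3/2 ≥ 0`
  have hK : 0 ≤ u ^ 2 * v * (6 * u ^ 5 + 5 * u ^ 4 * v + 4 * u ^ 3 * v ^ 2 + 3 * u ^ 2 * v ^ 3 +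
      2 * u * v ^ 4 + v ^ 5 - 6 * u ^ 2 - 4 * u * v - 2 * v ^ 2) - 3 / 2 := by
    have h1 : (9 / 10) ^ 3 * u ^ 2 ≤ u ^ 5 := by
      nlinarith [mul_nonneg (sub_nonneg.2 hu3) (sq_nonneg u)]
    have h2 : (9 / 10) ^ 3 * (u * v) ≤ u ^ 4 * v := by
      nlinarith [mul_nonneg (sub_nonneg.2 hu3) (mul_pos hu0 hv0).le]
    have h3 : (9 / 10) ^ 3 * v ^ 2 ≤ u ^ 3 * v ^ 2 := by
      nlinarith [mul_nonneg (sub_nonneg.2 hu3) (sq_nonneg v)]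
    have h4 : (9 / 10) ^ 3 * u ^ 2 ≤ u ^ 2 * v ^ 3 := by
      nlinarith [mul_nonneg (sub_nonneg.2 hv3) (sq_nonneg u)]
    have h5 : (9 / 10) ^ 3 * (u * v) ≤ u * v ^ 4 := by
      nlinarith [mul_nonneg (sub_nonneg.2 hv3) (mul_pos hu0 hv0).le]
    have h6 : (9 / 10) ^ 3 * v ^ 2 ≤ v ^ 5 := by
      nlinarith [mul_nonneg (sub_nonneg.2 hv3) (sq_nonneg v)]
    -- `K ≥ c₁u² + c₂uv + c₃v²` with `c₁ = 9m³−6`, `c₂ = 7m³−4`, `c₃ = 5m³−2`, then `u²v·(…) ≥ 3/2`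
    have hKlow : (9 * (9 / 10) ^ 3 - 6) * u ^ 2 + (7 * (9 / 10) ^ 3 - 4) * (u * v) +
        (5 * (9 / 10) ^ 3 - 2) * v ^ 2 ≤ 6 * u ^ 5 + 5 * u ^ 4 * v + 4 * u ^ 3 * v ^ 2 +
        3 * u ^ 2 * v ^ 3 + 2 * u * v ^ 4 + v ^ 5 - 6 * u ^ 2 - 4 * u * v - 2 * v ^ 2 := by
      nlinarith [h1, h2, h3, h4, h5, h6]
    have hu2 : (9 / 10) ^ 2 ≤ u ^ 2 := pow_le_pow_left₀ (by norm_num) hum 2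
    have hv2 : (9 / 10) ^ 2 ≤ v ^ 2 := pow_le_pow_left₀ (by norm_num) hvm 2
    have huv' : (9 / 10) ^ 2 ≤ u * v := by nlinarith
    have hlow : (9 * (9 / 10) ^ 3 - 6) * (9 / 10) ^ 2 + (7 * (9 / 10) ^ 3 - 4) * (9 / 10) ^ 2 +
        (5 * (9 / 10) ^ 3 - 2) * (9 / 10) ^ 2 ≤ (9 * (9 / 10) ^ 3 - 6) * u ^ 2 +
        (7 * (9 / 10) ^ 3 - 4) * (u * v) + (5 * (9 / 10) ^ 3 - 2) * v ^ 2 := by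
      nlinarith [hu2, hv2, huv']
    have hu2v : (9 / 10) ^ 3 ≤ u ^ 2 * v := by nlinarith [hu2, hvm]
    have hpos : 0 ≤ 6 * u ^ 5 + 5 * u ^ 4 * v + 4 * u ^ 3 * v ^ 2 + 3 * u ^ 2 * v ^ 3 +
        2 * u * v ^ 4 + v ^ 5 - 6 * u ^ 2 - 4 * u * v - 2 * v ^ 2 := by
      nlinarith [hKlow, hlow]
    nlinarith [mul_le_mul hu2v (hlow.trans hKlow) (by norm_num) (by positivity), hpos]
  have key : ((1 / 12) * v ^ 6 - (1 / 6) * v ^ 3) - ((1 / 12) * u ^ 6 - (1 / 6) * u ^ 3) -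
      (-(1 / 2) * u ^ 7 + (1 / 2) * u ^ 4) * ((u - v) / (u * v)) - (1 / 8) * ((u - v) / (u * v)) ^ 2 =
      (u - v) ^ 2 * (u ^ 2 * v * (6 * u ^ 5 + 5 * u ^ 4 * v + 4 * u ^ 3 * v ^ 2 + 3 * u ^ 2 * v ^ 3 +
        2 * u * v ^ 4 + v ^ 5 - 6 * u ^ 2 - 4 * u * v - 2 * v ^ 2) - 3 / 2) / (12 * (u * v) ^ 2) := by
    field_simp
    ring
  have h0 : 0 ≤ ((1 / 12) * v ^ 6 - (1 / 6) * v ^ 3) - ((1 / 12) * u ^ 6 - (1 / 6) * u ^ 3) -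
      (-(1 / 2) * u ^ 7 + (1 / 2) * u ^ 4) * ((u - v) / (u * v)) - (1 / 8) * ((u - v) / (u * v)) ^ 2 := by
    rw [key]
    apply div_nonneg _ (by positivity)
    have := sq_nonneg (u - v)
    exact mul_nonneg this hK
  linarith

end Literature.MathematicalPhysics.StatisticalMechanics
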